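import Literature.Topology.FourManifolds.TubeReadablePointwise
import Literature.Topology.FourManifolds.TubeFirstReadingOffset
import Literature.Topology.FourManifolds.TubePacing
import HarnessLib

/-!
# LEMMA A of the sweep: sector regions are readable

Topic `Literature/Topology/FourManifolds`; first of the two first-reading lemmas feeding the stage
interface `ShellPointReadable` (`TubeReadablePointwise.lean`) in the downward sweep of the smoothing
of PD homeomorphisms (Munkres, Ann. of Math. 72 (1960), §5; Campbell–D'Onofrio–Vítek (2026), §3).
At a shell point lying in an ORIGINAL SECTOR the current map is a smooth model `(T, N)` with the
secant offsets of `TubeFirstReadingOffset.lean`: on `K × B̄(0, r₀)` the fibre derivatives are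
`L`-Lipschitz in `y`, all derivatives are bounded by `M₁`, the fibre block at the zero section is
bounded below by `m` (`FibreBlock.lean`), and `‖N (x,0)‖, ‖T (x,0) − x‖ ≤ ε₀`,
`‖D_x N (x,0)‖, ‖D_x T (x,0) − I‖ ≤ ε₁`.  Then every shell point `q = (x, y)`, `x ∈ K`,
`r/4 ≤ ‖y‖ ≤ r`, is readable (`ShellPointReadable r ρ K₀ C₁ T N q`) as soon as the radius `r ≤ r₀`
satisfies the explicit smallness conditions

  `8 K₀ L r ≤ m`,  `16 K₀ ε₀ < m r`,  `ρ ≤ m / 4`,  `ε₀ ≤ r`,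
  `(L r + ε₁) (1 + 2 (M₁ + C₁ M₁ + C₁) / m) < 1`

(`shellPointReadable_of_sector`).  Note the WINDOW: `r` is bounded below by `16 K₀ ε₀ / m` (secant
offset) and above by the curvature scale; it is nonempty for fine subdivisions (`ε₀ = O(κ h²)`).
Everything is proved; no definitions; no named facts.

## References

* J. R. Munkres, *Obstructions to the smoothing of piecewise-differentiable homeomorphisms*, Ann.
  of Math. (2) 72 (1960), 521–554, §5. [Munkres1960]
* D. Campbell, L. D'Onofrio, T. Vítek, *Diffeomorphic approximation of piecewise affine
  homeomorphisms*, J. Geom. Anal. 36 (2026), §3. [CampbellDonofrioVitek2026]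
-/

noncomputable section

open Set Function Metric Filter
open scoped Topology ContDiff RealInnerProductSpace

namespace Literature.Topology.FourManifolds

variable {E : Type*} [NormedAddCommGroup E] [NormedSpace ℝ E]
variable {F : Type*} [NormedAddCommGroup F] [InnerProductSpace ℝ F]
variable {T : E × F → E} {N : E × F → F} {K : Set E} {r₀ r ρ K₀ C₁ L M₁ m ε₀ ε₁ : ℝ}

/-- The fibre derivative of `N` at `q` as a linear self-map of `F`. [folklore] -/
theorem fibreMap_apply (N : E × F → F) (q : E × F) (u : F) :
    ((fderiv ℝ N q).comp (ContinuousLinearMap.inr ℝ E F)) u = fderiv ℝ N q (0, u) := rfl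

/-- **LEMMA A: sector points are readable.** See the module docstring for the hypotheses.
[folklore] -/
theorem shellPointReadable_of_sector (hT : ContDiff ℝ ∞ T) (hN : ContDiff ℝ ∞ N)
    (hL0 : 0 ≤ L) (hM0 : 0 ≤ M₁) (hm : 0 < m) (hε₀0 : 0 ≤ ε₀) (hε₁0 : 0 ≤ ε₁) (hr₀ : 0 ≤ r₀)
    (hLN : ∀ x ∈ K, ∀ y ∈ closedBall (0 : F) r₀, ∀ y' ∈ closedBall (0 : F) r₀,
      ‖fderiv ℝ N (x, y) - fderiv ℝ N (x, y')‖ ≤ L * ‖y - y'‖)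
    (hLT : ∀ x ∈ K, ∀ y ∈ closedBall (0 : F) r₀, ∀ y' ∈ closedBall (0 : F) r₀,
      ‖fderiv ℝ T (x, y) - fderiv ℝ T (x, y')‖ ≤ L * ‖y - y'‖)
    (hMT : ∀ x ∈ K, ∀ y ∈ closedBall (0 : F) r₀, ‖fderiv ℝ T (x, y)‖ ≤ M₁)
    (hmN : ∀ x ∈ K, ∀ w : F, m * ‖w‖ ≤ ‖fderiv ℝ N (x, 0) (0, w)‖)
    (hN0 : ∀ x ∈ K, ‖N (x, 0)‖ ≤ ε₀) (hT0 : ∀ x ∈ K, ‖T (x, 0) - x‖ ≤ ε₀)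
    (hNx : ∀ x ∈ K, ∀ v : E, ‖fderiv ℝ N (x, 0) (v, 0)‖ ≤ ε₁ * ‖v‖)
    (hTx : ∀ x ∈ K, ∀ v : E, ‖fderiv ℝ T (x, 0) (v, 0) - v‖ ≤ ε₁ * ‖v‖)
    -- the constants of the stage and the radius
    (hK₀1 : 1 ≤ K₀) (hC₁0 : 0 ≤ C₁) (hr : 0 < r) (hrr₀ : r ≤ r₀)
    (h1 : 8 * K₀ * L * r ≤ m) (h2 : 16 * K₀ * ε₀ < m * r) (hρ : ρ ≤ m / 4) (h3 : ε₀ ≤ r)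
    (h4 : (L * r + ε₁) * (1 + 2 * (M₁ + C₁ * M₁ + C₁) / m) < 1)
    -- the shell point
    {q : E × F} (hq : q.1 ∈ K) (hq₁ : r / 4 ≤ ‖q.2‖) (hq₂ : ‖q.2‖ ≤ r) :
    ShellPointReadable r ρ K₀ C₁ T N q := by
  obtain ⟨x, y⟩ := q
  simp only at hq hq₁ hq₂ ⊢
  set t : ℝ := ‖y‖ with ht
  have ht0 : 0 < t := lt_of_lt_of_le (by positivity) hq₁
  have hy : y ∈ closedBall (0 : F) r₀ := by rw [mem_closedBall, dist_zero_right]; linarith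
  have hK₀0 : 0 < K₀ := by linarith
  -- `L t ≤ L r ≤ m / (8 K₀) ≤ m / 2`
  have hLr : L * r ≤ m / 2 := by
    have : L * r ≤ K₀ * L * r := by nlinarith [mul_nonneg hL0 hr.le]
    nlinarith
  have hsmall : L * ‖y‖ ≤ m / 2 := (mul_le_mul_of_nonneg_left hq₂ hL0).trans hLr
  -- (i) lower bound of `‖N (x, y)‖`
  have hNge : m / 2 * t - ε₀ ≤ ‖N (x, y)‖ := by
    have := norm_normal_ge_offset (K := K) (r₀ := r₀) hN hL0 hLN hmN hq hy hsmall
    linarith [hN0 x hq]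
  -- (ii) fibre lower bound at `(x, y)`
  have hfib : ∀ w : F, m / 2 * ‖w‖ ≤ ‖fderiv ℝ N (x, y) (0, w)‖ := fun w =>
    fibre_derivative_lower_bound hL0 hLN hmN hq hy hr₀ hsmall w
  -- (iii) source defect
  have hsrc : t ≤ r / 2 → ∀ u : F, fderiv ℝ N (x, y) (0, u) = fderiv ℝ N (x, y) (0, y) - N (x, y) →
      K₀ * ‖u‖ < t := by
    intro htr u hu
    have h := norm_source_defect_le_offset (K := K) (r₀ := r₀) hN hL0 hLN hmN hq hy hr₀ hsmall hu
    -- `(m/2)‖u‖ ≤ 2 L t² + ε₀`; multiply by `2K₀/m`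
    have hu1 : K₀ * ‖u‖ ≤ 2 * K₀ / m * (2 * L * t ^ 2 + ε₀) := by
      rw [div_mul_eq_mul_div, le_div_iff₀ hm]
      nlinarith [hN0 x hq]
    have hA : 2 * K₀ / m * (2 * L * t ^ 2) ≤ t / 4 := by
      -- `16 K₀ L t ≤ 8 K₀ L r ≤ m`
      rw [div_mul_eq_mul_div, div_le_iff₀ hm]
      have h16 : 16 * K₀ * L * t ≤ m := by
        have : 16 * K₀ * L * t ≤ 16 * K₀ * L * (r / 2) :=
          mul_le_mul_of_nonneg_left htr (by positivity)
        linarith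
      nlinarith [mul_le_mul_of_nonneg_right h16 ht0.le]
    have hB : 2 * K₀ / m * ε₀ < t / 2 := by
      rw [div_mul_eq_mul_div, div_lt_iff₀ hm]
      nlinarith
    calc K₀ * ‖u‖ ≤ 2 * K₀ / m * (2 * L * t ^ 2) + 2 * K₀ / m * ε₀ := by rw [← mul_add]; exact hu1
      _ < t / 4 + t / 2 := add_lt_add_of_le_of_lt hA hB
      _ ≤ t := by linarith
  refine
    { contDiffAt_N := hN.contDiffAt
      contDiffAt_T := fun _ => hT.contDiffAt
      N_ne_zero := ?_
      fibre_injective := ?_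
      source_defect := fun h => hsrc h
      transversal := ?_
      rho_le := ?_
      flatten := ?_ }
  · -- `N ≠ 0` at the link level
    intro h4r
    change ‖y‖ = r / 4 at h4r
    rw [← ht] at h4r
    rw [← norm_pos_iff]
    have : 0 < m / 2 * t - ε₀ := by
      rw [h4r]; nlinarith
    linarith
  · intro w hw
    have h := hfib w
    rw [hw, norm_zero] at h
    exact norm_eq_zero.1 (le_antisymm (by nlinarith [norm_nonneg w]) (norm_nonneg w))
  · -- transversality from the source defect at `t = r/4 ≤ r/2`
    intro h4r v hv
    change ‖y‖ = r / 4 at h4r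
    rw [← ht] at h4r
    have hy0 : y ≠ 0 := by rw [← norm_pos_iff]; exact ht0
    have hdef := hsrc (by rw [h4r]; linarith)
    exact inner_pos_of_euler_defect_lt' (L := ((fderiv ℝ N (x, y)).comp (ContinuousLinearMap.inr ℝ E F)).toLinearMap)
      hy0 hK₀1 (fun u hu => hdef u hu) hv
  · -- round radius
    intro h4r
    change ‖y‖ = r / 4 at h4r
    rw [← ht] at h4r
    have : ρ * (r / 4) ≤ m / 2 * t - ε₀ := by
      rw [h4r]
      nlinarith
    exact this.trans hNge
  · -- flatten data on `[5r/8, r]`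
    intro h58
    refine ⟨2 * (L * t + ε₁) / m, L * t + ε₁, M₁, M₁ * t + ε₀, hM0, by positivity, by positivity,
      ?_, ?_, ?_, ?_, ?_⟩
    · intro v w h0
      have h := kernel_slope_le_offset (K := K) (r₀ := r₀) hL0 hLN hmN hNx hq hy hr₀ hsmall h0
      rw [div_mul_eq_mul_div, le_div_iff₀ hm]
      linarith
    · intro v
      exact norm_fderiv_tangential_inl_sub_le_offset hL0 hLT hTx hq hy hr₀ v
    · intro w
      calc ‖fderiv ℝ T (x, y) (0, w)‖ ≤ ‖fderiv ℝ T (x, y)‖ * ‖((0 : E), w)‖ := ContinuousLinearMap.le_opNorm _ _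
        _ ≤ M₁ * ‖w‖ := by
            rw [Prod.norm_mk, norm_zero, max_eq_right (norm_nonneg w)]
            exact mul_le_mul_of_nonneg_right (hMT x hq y hy) (norm_nonneg w)
    · have h := norm_tangential_sub_le_offset (K := K) (r₀ := r₀) hT hMT hq hy hr₀
      linarith [hT0 x hq]
    · -- the coupling inequality
      set η : ℝ := L * r + ε₁ with hη
      have hη0 : 0 ≤ η := by positivity
      have hδ : L * t + ε₁ ≤ η := by nlinarith [mul_le_mul_of_nonneg_left hq₂ hL0]
      have hKle : 2 * (L * t + ε₁) / m ≤ 2 * η / m :=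
        div_le_div_of_nonneg_right (by linarith) hm.le
      have hD : C₁ / r * (M₁ * t + ε₀) ≤ C₁ * M₁ + C₁ := by
        rw [div_mul_eq_mul_div, div_le_iff₀ hr]
        have : C₁ * (M₁ * t) ≤ C₁ * M₁ * r := by nlinarith [mul_nonneg hC₁0 hM0]
        nlinarith [mul_le_mul_of_nonneg_left h3 hC₁0]
      have hCD : M₁ + C₁ / r * (M₁ * t + ε₀) ≤ M₁ + C₁ * M₁ + C₁ := by linarith
      have hCD0 : 0 ≤ M₁ + C₁ / r * (M₁ * t + ε₀) := by positivity
      calc L * t + ε₁ + (M₁ + C₁ / r * (M₁ * t + ε₀)) * (2 * (L * t + ε₁) / m)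
          ≤ η + (M₁ + C₁ * M₁ + C₁) * (2 * η / m) := by
            apply add_le_add hδ
            exact mul_le_mul hCD hKle (by positivity) (by positivity)
        _ = η * (1 + 2 * (M₁ + C₁ * M₁ + C₁) / m) := by ring
        _ < 1 := h4

end Literature.Topology.FourManifolds
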